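import Mathlib
import Literature.MathematicalPhysics.QuantumFieldTheory.Balaban1983to89.T4Rate166StripDirect

/-!
# `BalabanUV.Beta.FP.PerfectSymbolAlias` — road «FP» (binder row D1), leaf N0b-K-closed, PART 1: the `k = ∞` limits of the ONE-COORDINATE
# alias factors of Bałaban's block-averaging symbols, indexed by the INTEGER alias `l ∈ ℤ` (centred representatives), and the summable alias majorant

Road FP (fixed-point uniqueness; owner b2b-balaban-beta-d1-p3, gen 2; `HOME/b2b-balaban-beta-d1-p3/REP-DESIGN.md` v1.4 (L1), `LEAVES-FP.md` row N0b-K-closed).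
The perfect (k = ∞) objects of the road are so far NAMED LIMITS (`T4Rate166StripDirect.W166lim` = `limUnder` by King's rate; gan24-p3's `GsymLim`/`deltaZLim`/
`KPerf_eq_bloch_holds`).  This part supplies the elementary termwise limits from which PART 2 (`FP/PerfectSymbol166`) assembles the CLOSED FORM of the
continuum (1.66) multiplier as an alias series over `ℤ^d`:
* §1 `Sxi_two_pi_int`: `2πN`-periodicity of `S_ξ^{(N)}` under INTEGER multiples; `tendsto_Sxi_sq`: `S_ξ^{(N)}(w) = N²(2 − 2cos(w/N)) → w²`
  (`T4Rate166StripDirect.norm_Sxi_sub_sq_le`).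
* §2 the CENTRED REPRESENTATIVE `repFin N l : Fin N` of an integer alias `l` (`= l mod N`), `Sxi_shift_repFin` (the level-`N` symbol at the representative IS the
  symbol at `z + 2πl`), `repFin_eq_zero_iff` / `repFin_ne_zero` (for `N > |l|`: representative `0` iff `l = 0`).
* §3 the continuum one-coordinate weight `uInf l z := S₁(z)/(z + 2πl)²` (value `1` at `l = 0, z = 0`) — the factor `(2 sin(z/2)/(z + 2πl))²` of the perfect
  averaging weight `Π(p + 2πl)²` — and `tendsto_uFactor_repFin`: `uFactor N (repFin N l) z → uInf l z`.
* §4 `d` coordinates: `repK`, `UInf := Π_ν uInf`, `SqInf := Σ_ν (p_ν + 2πl_ν)²`, with `tendsto_U_repK`, `DeltaXi_shift_repK`, `tendsto_DeltaXi_shift_repK`.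
* §5 the centring `cen N k ∈ ℤ` of `k : Fin N` (inverse of `repFin` on the centred box `−N ≤ 2l < N`), `omega_repFin_ge` (`ω_N(rep l) ≥ (|l| + 1)/2` on the box) and
  the `N`-free summable alias majorant `maj l := Π_ν 256/(|l_ν| + 1)²` with `cω_repK_le_maj`, `summable_maj`.
[our object]/[folklore]: elementary analysis and bookkeeping over the tree's symbols (`B4Strip.Sxi/uFactor/U/DeltaXi/shift`, `B4StripSums.omega`,
`T4Rate166StripDirect.cω`); nothing about Bałaban's theorems is asserted; nothing is cited.  Orientation (not used): the `ℤ^d` alias series is the form in which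
the perfect free-gluon action is printed in W. Bietenholz, U.-J. Wiese, Nucl. Phys. B 464 (1996) 319, (3.13)/(3.16).
HONEST FRAMING: bookkeeping toward the explicit perfect objects of road FP (`hident`, GAPS O-asym1-7); discharges nothing of `BetaPertH`; NOT the continuum limit,
NOT Clay.  HONEST DEPENDENCY (verbatim): «continuum YM on T⁴ ⇐ BetaPertH ∧ nine spine estimates (0/9 proved); BetaPertH ⇐ (D1) ∧ (D4) ∧ CAP+tail; G-an2-4
gates asym, D1 and NE2/3/4.»
-/

noncomputable section

namespace Summit.QuantumFields.BalabanUV.Beta.FP.PerfectSymbolAlias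

open Filter Topology Finset
open scoped BigOperators
open Literature.MathematicalPhysics.QuantumFieldTheory.Balaban1983to89
open B4Strip (S1 Sxi DeltaXi shift uFactor U)
open B4StripCauchy (uFactor_zero_eq uFactor_ne_eq)
open B4StripSums (omega omega_pos one_le_omega)
open T4Rate166StripDirect (norm_Sxi_sub_sq_le cω)

variable {d : ℕ}

/-! ## §1 The fine second-difference symbol: integer periodicity and the `N → ∞` limit -/

/-- `S_ξ^{(N)}` is `2πN`-periodic under INTEGER multiples: `S_ξ^{(N)}(z + 2π·q·N) = S_ξ^{(N)}(z)`, `q ∈ ℤ`. [folklore] -/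
theorem Sxi_two_pi_int (N : ℕ) (hN : N ≠ 0) (z : ℂ) (q : ℤ) :
    Sxi N (z + 2 * Real.pi * ((q : ℂ) * N)) = Sxi N z := by
  have hN' : (N : ℂ) ≠ 0 := Nat.cast_ne_zero.mpr hN
  unfold Sxi
  have : (z + 2 * Real.pi * ((q : ℂ) * N)) / N = z / N + (q : ℂ) * (2 * Real.pi) := by field_simp
  rw [this, Complex.cos_add_int_mul_two_pi]

/-- **`S_ξ^{(N)}(w) → w²` as `N → ∞`** (fixed `w ∈ ℂ`; from `‖S_ξ^{(N)}(w) − w²‖ ≤ 2‖w‖⁴e^{‖w‖/N}/N²`). [folklore] -/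
theorem tendsto_Sxi_sq (w : ℂ) : Tendsto (fun j : ℕ => Sxi (j + 1) w) atTop (𝓝 (w ^ 2)) := by
  rw [tendsto_iff_norm_sub_tendsto_zero]
  have hb : ∀ j : ℕ, ‖Sxi (j + 1) w - w ^ 2‖ ≤ 2 * ‖w‖ ^ 4 * Real.exp ‖w‖ * (1 / ((j : ℝ) + 1)) := by
    intro j
    have h := norm_Sxi_sub_sq_le (j + 1) (by omega) w
    have hj : (0 : ℝ) < (j : ℝ) + 1 := by positivity
    have hexp : Real.exp (‖w‖ / ((j : ℝ) + 1)) ≤ Real.exp ‖w‖ :=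
      Real.exp_le_exp.mpr (div_le_self (norm_nonneg _) (by linarith))
    refine h.trans ?_
    push_cast
    rw [div_eq_mul_one_div]
    have h2 : 1 / ((j : ℝ) + 1) ^ 2 ≤ 1 / ((j : ℝ) + 1) := by
      refine div_le_div_of_nonneg_left zero_le_one hj ?_
      nlinarith
    have h4 : 0 ≤ 2 * ‖w‖ ^ 4 := by positivity
    exact mul_le_mul (mul_le_mul_of_nonneg_left hexp h4) h2 (by positivity) (by positivity)
  refine squeeze_zero (fun j => norm_nonneg _) hb ?_
  have h0 := tendsto_one_div_add_atTop_nhds_zero_nat.const_mul (2 * ‖w‖ ^ 4 * Real.exp ‖w‖)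
  rw [mul_zero] at h0
  exact h0

/-! ## §2 The centred representative of an integer alias -/

/-- [our object] The representative `l mod N ∈ {0,…,N−1}` of the integer alias `l`, as an element of `Fin N`. -/
def repFin (N : ℕ) [NeZero N] (l : ℤ) : Fin N :=
  ⟨(l % (N : ℤ)).toNat, by
    have hN : (0 : ℤ) < N := by exact_mod_cast Nat.pos_of_ne_zero (NeZero.ne N)
    have h0 : 0 ≤ l % (N : ℤ) := Int.emod_nonneg _ hN.ne'
    have h1 : l % (N : ℤ) < N := Int.emod_lt_of_pos _ hN
    omega⟩

/-- The representative as an integer is `l mod N`. [folklore] -/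
theorem repFin_coe (N : ℕ) [NeZero N] (l : ℤ) : ((repFin N l : ℕ) : ℤ) = l % (N : ℤ) := by
  have hN : (0 : ℤ) < N := by exact_mod_cast Nat.pos_of_ne_zero (NeZero.ne N)
  simp [repFin, Int.toNat_of_nonneg (Int.emod_nonneg _ hN.ne')]

/-- The representative as a complex number differs from `l` by an integer multiple of `N`. [folklore] -/
theorem repFin_cast (N : ℕ) [NeZero N] (l : ℤ) :
    ((repFin N l : ℕ) : ℂ) = (l : ℂ) + ((-(l / (N : ℤ)) : ℤ) : ℂ) * N := by
  have h := repFin_coe N l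
  have h2 : ((repFin N l : ℕ) : ℤ) = l + (-(l / (N : ℤ))) * N := by rw [h, Int.emod_def]; ring
  have h3 : ((repFin N l : ℕ) : ℂ) = (((repFin N l : ℕ) : ℤ) : ℂ) := by push_cast; rfl
  rw [h3, h2]; push_cast; ring

/-- **The level-`N` symbol at the representative IS the symbol at `z + 2πl`** (`2πN`-periodicity). [folklore] -/
theorem Sxi_shift_repFin (N : ℕ) [NeZero N] (l : ℤ) (z : ℂ) :
    Sxi N (z + 2 * Real.pi * ((repFin N l : ℕ) : ℂ)) = Sxi N (z + 2 * Real.pi * (l : ℂ)) := by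
  rw [repFin_cast N l, show z + 2 * Real.pi * ((l : ℂ) + ((-(l / (N : ℤ)) : ℤ) : ℂ) * N)
      = (z + 2 * Real.pi * (l : ℂ)) + 2 * Real.pi * (((-(l / (N : ℤ)) : ℤ) : ℂ) * N) by ring]
  exact Sxi_two_pi_int N (NeZero.ne N) _ _

/-- For `N > |l|` (here `|l| < N` as `-N < l < N`): the representative is `0` iff `l = 0`. [folklore] -/
theorem repFin_eq_zero_iff (N : ℕ) [NeZero N] {l : ℤ} (hl : -(N : ℤ) < l) (hl' : l < N) :
    (repFin N l : ℕ) = 0 ↔ l = 0 := by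
  have hN : (0 : ℤ) < N := by exact_mod_cast Nat.pos_of_ne_zero (NeZero.ne N)
  have h := repFin_coe N l
  constructor
  · intro h0
    rw [h0] at h
    push_cast at h
    -- `l % N = 0` with `|l| < N` forces `l = 0`
    have hdvd : (N : ℤ) ∣ l := Int.dvd_of_emod_eq_zero h.symm
    rcases hdvd with ⟨c, hc⟩
    rcases lt_trichotomy c 0 with hc0 | hc0 | hc0
    · nlinarith
    · rw [hc, hc0, mul_zero]
    · nlinarith
  · intro hl0
    subst hl0
    have : ((repFin N 0 : ℕ) : ℤ) = 0 := by rw [h]; simp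
    exact_mod_cast this

/-- Eventually (`N ≥ |l| + 1`) the representative of `l ≠ 0` is non-zero. [folklore] -/
theorem repFin_ne_zero (N : ℕ) [NeZero N] {l : ℤ} (hl : -(N : ℤ) < l) (hl' : l < N) (hl0 : l ≠ 0) :
    (repFin N l : ℕ) ≠ 0 := fun h => hl0 ((repFin_eq_zero_iff N hl hl').mp h)

/-! ## §3 The continuum one-coordinate averaging weight and the termwise limit -/

/-- [our object] **THE CONTINUUM ONE-COORDINATE WEIGHT** `u_∞(l; z) := S₁(z)/(z + 2πl)² = (2 sin(z/2)/(z + 2πl))²` (value `1` at `l = 0`, `z = 0`,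
the removable singularity): the `k = ∞` limit of `B4Strip.uFactor`, i.e. the factor of the squared Fourier transform of the unit tent/box at the alias `l`. -/
def uInf (l : ℤ) (z : ℂ) : ℂ := if l = 0 ∧ z = 0 then 1 else S1 z / (z + 2 * Real.pi * (l : ℂ)) ^ 2

/-- **TERMWISE LIMIT OF THE ONE-COORDINATE FACTOR**: for `z + 2πl ≠ 0` unless `(l, z) = (0, 0)`,
`uFactor N (repFin N l) z → u_∞(l; z)` as `N → ∞`. [folklore] -/
theorem tendsto_uFactor_repFin (l : ℤ) (z : ℂ) (hz : z + 2 * Real.pi * (l : ℂ) ≠ 0 ∨ (l = 0 ∧ z = 0)) :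
    Tendsto (fun j : ℕ => uFactor (j + 1) (repFin (j + 1) l : ℕ) z) atTop (𝓝 (uInf l z)) := by
  by_cases hl0 : l = 0
  · subst hl0
    have hrep : ∀ j : ℕ, (repFin (j + 1) 0 : ℕ) = 0 := fun j =>
      (repFin_eq_zero_iff (j + 1) (by push_cast; linarith) (by push_cast; linarith)).mpr rfl
    simp only [hrep, uFactor_zero_eq]
    by_cases hz0 : z = 0
    · subst hz0; simp [uInf]
    · have hne : z ≠ 0 := hz0
      simp only [hz0, if_false, uInf, and_false, Int.cast_zero, mul_zero, add_zero]
      have ht := tendsto_Sxi_sq z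
      have hz2 : z ^ 2 ≠ 0 := pow_ne_zero 2 hne
      exact (tendsto_const_nhds (x := S1 z)).div ht hz2
  · -- `l ≠ 0`: eventually the representative is non-zero and the shifted symbol is the one at `z + 2πl`
    have hw : z + 2 * Real.pi * (l : ℂ) ≠ 0 := by
      rcases hz with h | ⟨h, _⟩
      · exact h
      · exact absurd h hl0
    have hev : ∀ᶠ j : ℕ in atTop, uFactor (j + 1) (repFin (j + 1) l : ℕ) z
        = S1 z / Sxi (j + 1) (z + 2 * Real.pi * (l : ℂ)) := by
      rw [eventually_atTop]
      refine ⟨l.natAbs, fun j hj => ?_⟩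
      have ha : l ≤ (l.natAbs : ℤ) := Int.le_natAbs
      have hb : -l ≤ (l.natAbs : ℤ) := by have := Int.le_natAbs (a := -l); rwa [Int.natAbs_neg] at this
      have h1 : -((j + 1 : ℕ) : ℤ) < l := by push_cast; omega
      have h2 : l < ((j + 1 : ℕ) : ℤ) := by push_cast; omega
      rw [uFactor_ne_eq _ _ (repFin_ne_zero (j + 1) h1 h2 hl0), Sxi_shift_repFin]
    simp only [uInf, hl0, false_and, if_false]
    refine Tendsto.congr' (EventuallyEq.symm hev) ?_
    exact (tendsto_const_nhds (x := S1 z)).div (tendsto_Sxi_sq _) (pow_ne_zero 2 hw)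

/-! ## §4 `d` coordinates: the alias vector `l : Fin d → ℤ` -/

/-- [our object] The representative residue vector of an integer alias vector. -/
def repK (N : ℕ) [NeZero N] (l : Fin d → ℤ) : Fin d → Fin N := fun ν => repFin N (l ν)

/-- [our object] The continuum averaging weight `U_∞(l; p) := Π_ν u_∞(l_ν; p_ν)` (= `Π(p + 2πl)²` of the perfect-action literature). -/
def UInf (l : Fin d → ℤ) (p : Fin d → ℂ) : ℂ := ∏ ν, uInf (l ν) (p ν)

/-- [our object] The continuum Laplacian symbol at the alias: `Σ_ν (p_ν + 2πl_ν)²`. -/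
def SqInf (l : Fin d → ℤ) (p : Fin d → ℂ) : ℂ := ∑ ν, (p ν + 2 * Real.pi * ((l ν : ℤ) : ℂ)) ^ 2

/-- `U N (repK N l) p → U_∞(l; p)` termwise (product of the one-coordinate limits). [folklore] -/
theorem tendsto_U_repK (l : Fin d → ℤ) (p : Fin d → ℂ)
    (hp : ∀ ν, p ν + 2 * Real.pi * ((l ν : ℤ) : ℂ) ≠ 0 ∨ (l ν = 0 ∧ p ν = 0)) :
    Tendsto (fun j : ℕ => U (j + 1) (repK (j + 1) l) p) atTop (𝓝 (UInf l p)) := by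
  unfold U UInf repK
  exact tendsto_finsetProd _ fun ν _ => tendsto_uFactor_repFin (l ν) (p ν) (hp ν)

/-- The shifted fine Laplacian symbol at the representative alias vector IS the one at `p + 2πl`. [folklore] -/
theorem DeltaXi_shift_repK (N : ℕ) [NeZero N] (l : Fin d → ℤ) (p : Fin d → ℂ) :
    DeltaXi N 0 (shift N (repK N l) p) = ∑ ν, Sxi N (p ν + 2 * Real.pi * ((l ν : ℤ) : ℂ)) := by
  unfold DeltaXi shift repK
  push_cast
  rw [add_zero]
  exact Finset.sum_congr rfl fun ν _ => Sxi_shift_repFin N (l ν) (p ν)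

/-- `(Δ^ξ)^{(N)}(p + 2π·rep l) → Σ_ν (p_ν + 2πl_ν)²` termwise. [folklore] -/
theorem tendsto_DeltaXi_shift_repK (l : Fin d → ℤ) (p : Fin d → ℂ) :
    Tendsto (fun j : ℕ => DeltaXi (j + 1) 0 (shift (j + 1) (repK (j + 1) l) p)) atTop (𝓝 (SqInf l p)) := by
  simp only [DeltaXi_shift_repK]
  unfold SqInf
  exact tendsto_finsetSum _ fun ν _ => tendsto_Sxi_sq _

/-! ## §5 Centring, the distance weight at a representative, and the summable alias majorant -/

/-- [our object] The CENTRED integer alias of a residue `k ∈ {0,…,N−1}`: `k` if `2k < N`, else `k − N` (so `−N ≤ 2·cen < N`). -/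
def cen (N : ℕ) (k : ℕ) : ℤ := if 2 * k < N then (k : ℤ) else (k : ℤ) - N

/-- The centred alias lies in the centred box `−N ≤ 2l < N`. [folklore] -/
theorem cen_mem_box (N : ℕ) {k : ℕ} (hk : k < N) : -(N : ℤ) ≤ 2 * cen N k ∧ 2 * cen N k < N := by
  unfold cen; split_ifs <;> constructor <;> omega

/-- `repFin N (cen N k) = k` for `k < N`. [folklore] -/
theorem repFin_cen (N : ℕ) [NeZero N] (k : Fin N) : repFin N (cen N k) = k := by
  apply Fin.ext
  have h := repFin_coe N (cen N k)
  have hk := k.isLt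
  have hN : (0 : ℤ) < N := by exact_mod_cast Nat.pos_of_ne_zero (NeZero.ne N)
  have hmod : (cen N k) % (N : ℤ) = k := by
    unfold cen
    split_ifs with h2
    · exact Int.emod_eq_of_lt (by positivity) (by exact_mod_cast hk)
    · rw [show ((k : ℕ) : ℤ) - (N : ℤ) = (k : ℤ) + (N : ℤ) * (-1) by ring, Int.add_mul_emod_self_left]
      exact Int.emod_eq_of_lt (by positivity) (by exact_mod_cast hk)
  rw [hmod] at h
  exact_mod_cast h

/-- `cen N (repFin N l) = l` on the centred box `−N ≤ 2l < N`. [folklore] -/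
theorem cen_repFin (N : ℕ) [NeZero N] {l : ℤ} (hl : -(N : ℤ) ≤ 2 * l) (hl' : 2 * l < N) : cen N (repFin N l) = l := by
  have hN : (0 : ℤ) < N := by exact_mod_cast Nat.pos_of_ne_zero (NeZero.ne N)
  have h := repFin_coe N l
  unfold cen
  by_cases h0 : 0 ≤ l
  · have hm : l % (N : ℤ) = l := Int.emod_eq_of_lt h0 (by omega)
    rw [hm] at h
    have h2 : 2 * (repFin N l : ℕ) < N := by zify; rw [h]; exact hl'
    rw [if_pos h2, h]
  · have hm : l % (N : ℤ) = l + N := by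
      have e1 : ((l + N) + (N : ℤ) * (-1)) % N = (l + N) % N := Int.add_mul_emod_self_left _ _ _
      rw [show (l + N) + (N : ℤ) * (-1) = l by ring] at e1
      rw [e1]
      exact Int.emod_eq_of_lt (by omega) (by omega)
    rw [hm] at h
    have h2 : ¬ 2 * (repFin N l : ℕ) < N := by zify; rw [h]; omega
    rw [if_neg h2, h]; ring

/-- **Distance weight at a representative**: on the centred box, `(|l| + 1)/2 ≤ ω_N(repFin N l)`. [folklore] -/
theorem omega_repFin_ge (N : ℕ) [NeZero N] {l : ℤ} (hl : -(N : ℤ) ≤ 2 * l) (hl' : 2 * l < N) :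
    ((l.natAbs : ℝ) + 1) / 2 ≤ omega N (repFin N l) := by
  have hN : (0 : ℤ) < N := by exact_mod_cast Nat.pos_of_ne_zero (NeZero.ne N)
  have h := repFin_coe N l
  have habs : ((l.natAbs : ℤ) : ℝ) = (l.natAbs : ℝ) := Int.cast_natCast l.natAbs
  unfold omega
  by_cases h0 : 0 ≤ l
  · have hm : l % (N : ℤ) = l := Int.emod_eq_of_lt h0 (by omega)
    rw [hm] at h
    have hr : ((repFin N l : ℕ) : ℝ) = (l : ℝ) := by exact_mod_cast h
    have ha : ((l.natAbs : ℕ) : ℝ) = (l : ℝ) := by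
      rw [← habs, Int.natAbs_of_nonneg h0]
    have hlN : 2 * (l : ℝ) + 1 ≤ N := by exact_mod_cast (show 2 * l + 1 ≤ (N : ℤ) by omega)
    have hl0 : (0 : ℝ) ≤ l := by exact_mod_cast h0
    rw [hr, ha]
    refine le_min ?_ ?_ <;> linarith
  · push Not at h0
    have hm : l % (N : ℤ) = l + N := by
      have e1 : ((l + N) + (N : ℤ) * (-1)) % N = (l + N) % N := Int.add_mul_emod_self_left _ _ _
      rw [show (l + N) + (N : ℤ) * (-1) = l by ring] at e1
      rw [e1]
      exact Int.emod_eq_of_lt (by omega) (by omega)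
    rw [hm] at h
    have hr : ((repFin N l : ℕ) : ℝ) = (l : ℝ) + N := by exact_mod_cast h
    have ha : ((l.natAbs : ℕ) : ℝ) = -(l : ℝ) := by
      rw [← habs, Int.ofNat_natAbs_of_nonpos h0.le]; push_cast; ring
    have hlN : -(N : ℝ) ≤ 2 * (l : ℝ) := by exact_mod_cast hl
    have hl0 : (l : ℝ) + 1 ≤ 0 := by exact_mod_cast (show l + 1 ≤ (0 : ℤ) by omega)
    rw [hr, ha]
    refine le_min ?_ ?_ <;> linarith

/-- [our object] The `N`-FREE alias majorant `maj l := Π_ν 256/(|l_ν| + 1)²`. -/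
def maj (l : Fin d → ℤ) : ℝ := ∏ ν, 256 / (((l ν).natAbs : ℝ) + 1) ^ 2

/-- `0 ≤ maj l`. [folklore] -/
theorem maj_nonneg (l : Fin d → ℤ) : 0 ≤ maj l := Finset.prod_nonneg fun ν _ => by positivity

/-- On the centred box, the tree's alias majorant at the representative is dominated by the `N`-free one: `cω_N(repK N l) ≤ maj l`. [folklore] -/
theorem cω_repK_le_maj (N : ℕ) [NeZero N] {l : Fin d → ℤ} (hl : ∀ ν, -(N : ℤ) ≤ 2 * l ν ∧ 2 * l ν < N) :
    cω N (repK N l) ≤ maj l := by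
  unfold cω maj repK
  refine Finset.prod_le_prod (fun ν _ => by have := omega_pos N _ (repFin N (l ν)).isLt; positivity) fun ν _ => ?_
  have hω := omega_repFin_ge N (hl ν).1 (hl ν).2
  have ha : (0 : ℝ) < ((l ν).natAbs : ℝ) + 1 := by positivity
  have hω0 : 0 < omega N (repFin N (l ν)) := omega_pos N _ (repFin N (l ν)).isLt
  rw [div_le_div_iff₀ (by positivity) (by positivity)]
  have h2 : (((l ν).natAbs : ℝ) + 1) ^ 2 ≤ 4 * omega N (repFin N (l ν)) ^ 2 := by nlinarith
  nlinarith

/-- `Σ_{i ∈ ℤ} 1/(|i| + 1)²` converges. [folklore] -/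
theorem summable_inv_natAbs_sq : Summable fun i : ℤ => 1 / ((i.natAbs : ℝ) + 1) ^ 2 := by
  have hnat : Summable fun n : ℕ => 1 / ((n : ℝ) + 1) ^ 2 := by
    have h := (summable_nat_add_iff 1).mpr (Real.summable_one_div_nat_pow.mpr one_lt_two)
    refine h.congr fun n => ?_
    simp only [Nat.cast_add, Nat.cast_one]
  refine summable_int_iff_summable_nat_and_neg.mpr ⟨?_, ?_⟩
  · refine hnat.congr fun n => ?_
    simp only [Int.natAbs_natCast]
  · refine hnat.congr fun n => ?_
    simp only [Int.natAbs_neg, Int.natAbs_natCast]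

/-- Products of non-negative summable one-coordinate functions are summable on `Fin n → ℤ`. [folklore] -/
theorem summable_pi_prod {a : ℤ → ℝ} (ha : Summable a) (ha0 : ∀ i, 0 ≤ a i) :
    ∀ n : ℕ, Summable fun l : Fin n → ℤ => ∏ ν, a (l ν) := by
  intro n
  induction n with
  | zero =>
    exact Summable.of_finite
  | succ n ih =>
    have hf' : (0 : ℤ → ℝ) ≤ a := Pi.le_def.mpr fun i => by simpa using ha0 i
    have hg' : (0 : (Fin n → ℤ) → ℝ) ≤ fun l => ∏ ν, a (l ν) :=
      Pi.le_def.mpr fun l => by simpa using Finset.prod_nonneg fun ν (_ : ν ∈ Finset.univ) => ha0 (l ν)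
    -- (no expected type on `h2`: the product lemma's higher-order unification must run bottom-up)
    have h2 := Summable.mul_of_nonneg ha ih hf' hg'
    refine ((Fin.consEquiv fun _ : Fin (n + 1) => ℤ).summable_iff (f := fun l : Fin (n + 1) → ℤ => ∏ ν, a (l ν))).mp ?_
    refine h2.congr fun x => ?_
    simp [Function.comp, Fin.prod_univ_succ, Fin.consEquiv]

/-- **The `N`-free alias majorant is summable over `ℤ^d`.** [folklore] -/
theorem summable_maj : Summable (maj (d := d)) := by
  have h := summable_pi_prod (summable_inv_natAbs_sq.mul_left 256) (fun i => by positivity) d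
  refine h.congr fun l => ?_
  unfold maj
  exact Finset.prod_congr rfl fun ν _ => by ring

/-! ## §6 Re-indexing the alias sum of level `N` by the centred box of `ℤ^d` -/

/-- [our object] the centred box of level `N` in `ℤ`: `{l : −N ≤ 2l < N}`. -/
def box (N : ℕ) : Finset ℤ := (Finset.Icc (-(N : ℤ)) N).filter fun l => -(N : ℤ) ≤ 2 * l ∧ 2 * l < N

/-- membership in the centred box. [folklore] -/
theorem mem_box {N : ℕ} {l : ℤ} : l ∈ box N ↔ -(N : ℤ) ≤ 2 * l ∧ 2 * l < N := by
  unfold box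
  simp only [Finset.mem_filter, Finset.mem_Icc, and_iff_right_iff_imp]
  intro h; omega

/-- [our object] the centred box of level `N` in `ℤ^d`. -/
def boxK (d N : ℕ) : Finset (Fin d → ℤ) := Fintype.piFinset fun _ => box N

/-- membership in the `d`-dimensional centred box. [folklore] -/
theorem mem_boxK {N : ℕ} {l : Fin d → ℤ} : l ∈ boxK d N ↔ ∀ ν, -(N : ℤ) ≤ 2 * l ν ∧ 2 * l ν < N := by
  unfold boxK; simp only [Fintype.mem_piFinset, mem_box]

/-- [our object] the centring of a residue vector. -/
def cenK (N : ℕ) (k : Fin d → Fin N) : Fin d → ℤ := fun ν => cen N (k ν)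

/-- **RE-INDEXING**: a sum over the residue vectors `Fin d → Fin N` IS the sum over the centred box of `ℤ^d` at the representatives. [folklore] -/
theorem sum_fin_eq_sum_boxK (N : ℕ) [NeZero N] {M : Type*} [AddCommMonoid M] (g : (Fin d → Fin N) → M) :
    ∑ k, g k = ∑ l ∈ boxK d N, g (repK N l) := by
  refine Finset.sum_nbij' (cenK N) (repK N) (fun k _ => mem_boxK.mpr fun ν => cen_mem_box N (k ν).isLt)
    (fun l _ => Finset.mem_univ _) (fun k _ => funext fun ν => repFin_cen N (k ν))
    (fun l hl => funext fun ν => cen_repFin N ((mem_boxK.mp hl) ν).1 ((mem_boxK.mp hl) ν).2) (fun k _ => ?_)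
  show g k = g (repK N (cenK N k))
  congr 1; funext ν; exact (repFin_cen N (k ν)).symm

/-- On the centred box (`N ≥ 1`): the representative vector is `0` iff the alias vector is `0`. [folklore] -/
theorem repK_eq_zero_iff (N : ℕ) [NeZero N] {l : Fin d → ℤ} (hl : l ∈ boxK d N) :
    repK N l = (fun _ => (0 : Fin N)) ↔ l = 0 := by
  have hb := mem_boxK.mp hl
  constructor
  · intro h; funext ν
    have hν := congrFun h ν
    have h0 : (repFin N (l ν) : ℕ) = 0 := by
      have := congrArg Fin.val hν; simpa [repK] using this
    exact (repFin_eq_zero_iff N (by have := (hb ν).1; omega) (by have := (hb ν).2; omega)).mp h0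
  · intro h; subst h; funext ν
    apply Fin.ext
    have := (repFin_eq_zero_iff N (l := 0) (by simp [Nat.pos_of_ne_zero (NeZero.ne N)])
      (by exact_mod_cast Nat.pos_of_ne_zero (NeZero.ne N))).mpr rfl
    simpa [repK] using this

/-- a fixed alias vector lies in the centred box of every large level. [folklore] -/
theorem eventually_mem_boxK (l : Fin d → ℤ) : ∀ᶠ j : ℕ in atTop, l ∈ boxK d (j + 1) := by
  rw [eventually_atTop]
  refine ⟨2 * ∑ ν, (l ν).natAbs, fun j hj => mem_boxK.mpr fun ν => ?_⟩
  have h1 : (l ν).natAbs ≤ ∑ μ, (l μ).natAbs :=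
    Finset.single_le_sum (f := fun μ => (l μ).natAbs) (fun μ _ => Nat.zero_le _) (Finset.mem_univ ν)
  have h1' : 2 * ((l ν).natAbs : ℤ) ≤ j := by exact_mod_cast (Nat.mul_le_mul_left 2 h1).trans hj
  have ha : l ν ≤ ((l ν).natAbs : ℤ) := Int.le_natAbs
  have hb : -l ν ≤ ((l ν).natAbs : ℤ) := by have := Int.le_natAbs (a := -l ν); rwa [Int.natAbs_neg] at this
  constructor <;> push_cast <;> omega

end Summit.QuantumFields.BalabanUV.Beta.FP.PerfectSymbolAlias

end
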